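import Summits.BirchSwinnertonDyer.BirchSwinnertonDyer.Theses.LeadingTerm
import Literature.NumberTheory.EllipticCurves.Heights
import Literature.NumberTheory.EllipticCurves.MordellWeilTheoremProofs

/-!
# Strategist s2·gen 2 sketch for `SqueezeUBR2` (stmt-BirchSwinnertonDyer-0145): the height split D13 / S13

Typed ONLY to certify that the census signatures elaborate (STRATEGY-CENSUS.md v5, §Strengthen S13,
§Decomposition D13). NOT filed: piece 2 is a consequence of the crux uniformly in `B`
(`smallPointUB_of_squeezeUBR2`) and carries all of its difficulty; piece 1 is a Lang-type height
conjecture. No leverage — see the census for the reason.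
-/

namespace Summit.BirchSwinnertonDyer.BirchSwinnertonDyer.Cruxes.SqueezeUB.StrategistG2

open WeierstrassCurve.Affine.Point

-- tree convention (MordellWeil.lean / Heights.lean elaborate `E(K)` under `open scoped Classical`):
-- resolve `DecidableEq ℚ` classically so our terms match the baked ones.
attribute [local instance 1100] Classical.propDecidable

/-- D13 piece 1 (`SmallBasis B`): every elliptic curve over `ℚ` has `rank_ℤ E(ℚ)` ℤ-linearly
independent rational points of Néron–Tate height at most `B E` (successive-minima / Lang-type
bound; open for every explicit `B`). -/
def SmallBasis (B : WeierstrassCurve ℚ → ℝ) : Prop :=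
  ∀ (W : WeierstrassCurve ℚ) [W.IsElliptic],
    ∃ s : Fin W.mordellWeilRank → W.toAffine.Point,
      LinearIndependent ℤ s ∧ ∀ i, canonicalHeight (s i) ≤ B W

/-- D13 piece 2 (`SmallPointUB B`): ℤ-independent rational points of Néron–Tate height `≤ B E`
number at most `ord_{s=1} L(E,s)` ("no excess rank among small points"). -/
def SmallPointUB (B : WeierstrassCurve ℚ → ℝ) : Prop :=
  ∀ (W : WeierstrassCurve ℚ) [W.IsElliptic] (k : ℕ),
    (∃ s : Fin k → W.toAffine.Point, LinearIndependent ℤ s ∧ ∀ i, canonicalHeight (s i) ≤ B W) →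
      k ≤ W.analyticRank

/-- The join (trivial seam): `SmallBasis B → SmallPointUB B → SqueezeUBR2`. -/
theorem squeezeUBR2_of_smallBasis_of_smallPointUB (B : WeierstrassCurve ℚ → ℝ)
    (h₁ : SmallBasis B) (h₂ : SmallPointUB B) :
    Summit.BirchSwinnertonDyer.BirchSwinnertonDyer.Theses.LeadingTerm.SqueezeUBR2 := by
  intro W hW
  obtain ⟨s, hs, hB⟩ := h₁ W
  exact h₂ W W.mordellWeilRank ⟨s, hs, hB⟩

/-- Conversely the crux gives piece 2 for EVERY `B` (Mordell–Weil, proved in the tree as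
`WeierstrassCurve.module_finite_point_holds`, makes `k` independent points number `≤ rank`):
piece 2 is a consequence of the crux, uniformly in `B`. -/
theorem smallPointUB_of_squeezeUBR2 (B : WeierstrassCurve ℚ → ℝ)
    (h : Summit.BirchSwinnertonDyer.BirchSwinnertonDyer.Theses.LeadingTerm.SqueezeUBR2) :
    SmallPointUB B := by
  intro W hW k hk
  obtain ⟨s, hs, _⟩ := hk
  haveI : Module.Finite ℤ W.toAffine.Point := W.module_finite_point_holds
  have hk' : k ≤ W.mordellWeilRank := by
    simpa [WeierstrassCurve.mordellWeilRank] using hs.fintype_card_le_finrank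
  exact hk'.trans (h W)

end Summit.BirchSwinnertonDyer.BirchSwinnertonDyer.Cruxes.SqueezeUB.StrategistG2
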